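import Summits.BirchSwinnertonDyer.Rank1Residual.ManinAdditive.ThetaFourBrandtDegreeLawAtNine
import HarnessLib
import HarnessLib.Audit.Tags

/-!
# The DEPTH-ONE Brandt degree law at `27 ∥ N`: rows E-desc-125 `DepthOneBrandtDegreeLawAtTwentySevenPrime` and
# E-desc-126 `DepthOneKindLawAtTwentySevenPrime` typed (Kodaira II, IV, IV*, II* at 3)
# (cell `bsd-f2-manin`, desc g18 EXTRA, MEMO-desc §40; nothing asserted)

TYPER NOTE (typer g18, T-desc-33).  SOURCE = HOME/desc/g18/Sketch-desc-g18d.lean sha16 711fd429b2ece788 (362 l.; desc: farm rc 0 · 0 err · 0 warn ·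
nothing admitted, 48.2 s, check-g18d-v3.json eaa412e598479935; BC7 ProbeG18e.txt 2/2 CLEAN), landed VERBATIM under the file name, namespace
(`…ManinAdditive.ThetaFourBrandt`, `section DepthOne`) and imports the planner asked for (only the landed `ThetaFourBrandtDegreeLawAtNine` p707444 +
HarnessLib); nothing renamed, nothing added except this note and two one-line docstrings (gate lint) on `F9.mul_inv_self` / `red3_units_c_ne_zero`.  By-name targets: **E-desc-125 `ThetaFourBrandt.DepthOneBrandtDegreeLawAtTwentySevenPrime`**,
**E-desc-126 `ThetaFourBrandt.DepthOneKindLawAtTwentySevenPrime`** (`@[conjecture]` nodes, nothing asserted), PROVED prime-level reading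
`isThreeEisensteinDegenerateAtTwentySeven_iff_of_conductor_eq`, kernel certificates `F189a1`/`F189d1` (`p = 7`, kind nsq), `F297d1` (`p = 11`, sq),
`F459c1` (`p = 17`, nsq).  HONEST FRAMING.  LENS: desc (quaternionic descent: the depth-one / conductor-27 supercuspidal Brandt module of `B_{3,∞}`,
the last additive stratum at 3).  STATUS: LAWS (CONJECTURAL identities; desc: NOT in print for the character module at a supercuspidal prime;
beyond-print theorem: NO); they read `deg φ`, not the Manin constant.  BC5 WITNESS: HOME/desc/g18/b27/CENSUS-27.md 7e13940c783c600b, row file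
CENSUS-27.txt 3019b3d035415bc1 (568/568 optimal curves `27 ∥ N = 27M ≤ 9747`, `M` odd prime to 3, 87 levels; E-desc-126 kind law 568/568),
JL27-CHECK-499.txt 68240bd5812eb732 (Jacquet–Langlands dimension identity 166/166 odd levels `M < 500`); engine brandt27.py f05b4f50d49d2f06.
REFUTER VERDICTS: R-desc-31 (ref1) PENDING at filing; ref2 PENDING.  CHEAPEST FALSIFIER (desc): a split-coherent `μ₃`-curve with `3 ∣ v_q(Δ)` at an
all-`q ≡ 2 (3)` square-free level, or any optimal curve at `27 ∥ N > 9747` off the law.  PARTITION currency: 0; bears_on: stmt-BirchSwinnertonDyer-22968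
(C3 at `27 ∥ N`).  BSD is not proved by this; Manin's conjecture is not proved; C2/C3 OPEN.

SKETCH (planner bsd-f2-manin-desc g18).  Continuation of the landed `ThetaFourBrandtDegreeLawAtNine.lean` (`9 ∥ N`,
rows E-desc-123/124; this file reuses its `dicyclicOfNorm`, `dicyclicUnits`, `act3` and the doubled-coordinate
conventions of `HurwitzBrandt.DQuat`) to the LAST additive stratum at 3, `v₃(N) = 3`.  Engine + census:
`HOME/desc/g18/b27/` (`brandt27.py` f05b4f50d49d2f06, `run27.py` 6036f168a3b60adf, `census27.py`, `CENSUS-27.md`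
7e13940c783c600b, row file `CENSUS-27.txt` 3019b3d035415bc1 (568 rows), `JL27-CHECK-499.txt` 68240bd5812eb732);
pack `HOME/desc/g18/SHA16SUMS.desc.g18`.

SUMMARY.  (1) THE OBJECT: for `p ≥ 5` prime and a "kind" `α ∈ {sq, nsq}` the depth-one module `M_α(p) ⊂ (ℤ[ω])^{4(p+1)}`
of `B_{3,∞} = (−1,−3)_ℚ` — functions on `(𝔽₉^×/±1) × ℙ¹(𝔽_p)` invariant under the 12 units for the action twisted by the
additive character `ψ_α` of `1 + jO ⊂ (O/3O)^×` (§6 docstring: the two kinds = the two 4-dimensional irreducibles of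
`(O/3O)^×/𝔽₃^×` = the two Galois orbits of conductor-27 supercuspidal types), with Hecke operators `T_ℓ = (1/12) Σ_{Nrd γ = ℓ}
L_γ` and height `⟨F,F⟩ = Σ_orbits w·Nm F`.  (2) JACQUET–LANGLANDS, CHECKED at all 166 odd levels `M < 500` prime to 3
(prime and composite): `dim M_sq(M) + dim M_nsq(M) = Σ_{d ∣ M} σ₀(M/d) dim S₂^{new}(Γ₀(27d))` — no Eisenstein line, no
depth-zero part.  (3) THE LAW (E-desc-125): for EVERY one of the 568 `X₀(N)`-optimal curves with `27 ∥ N = 27M ≤ 9747`,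
`M` odd prime to 3 (87 levels), the `f_E`-eigenline lies in exactly one kind, is free of rank one over `ℤ[ω]`, and
  `deg φ_E = 3^{1 + b(E) − t₃(E)} · ⟨F_E, F_E⟩`,  `b = [IV* or II*] = [v₃(Δ) ≥ 9]`,  `t₃ = [sign-coherent 3-Eisenstein degenerate]`
(ratio `deg φ/⟨F,F⟩`: II → 3 (197) or 1 (3); IV → 3 (108); IV* → 9 (149) or 3 (3); II* → 9 (108)); hence `ord_ℓ deg φ =
ord_ℓ ⟨F_E,F_E⟩` for EVERY prime `ℓ ≠ 3` INCLUDING `ℓ = 2` (568/568: no 2-correction at `27 ∥ N`, in contrast with `t(E)` of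
E-desc-117 at `4 ∥ N` and `t₂(E)` of E-desc-123 at `9 ∥ N`).  (4) THE 3-EISENSTEIN BIT `t₃` is NOT the verbatim transplant
of E-desc-117's `t` ("rational 3-structure, `3 ∤ c_q`, `q ≡ 2 (3)`"; that candidate mispredicts 13 of 568 rows): the six
degenerate curves `459c1/459f1, 1485c1/1485d1, 6831f1/6831b1` are the three `χ₋₃`-twin pairs (II with `μ₃ ⊂ E` ↔ IV* with
`ℤ/3 ⊂ E`) in which the rational order-3 subgroup is TORIC at every `q ∣ M` (`a_q = −1` for `ℤ/3`, `a_q = +1` for `μ₃`,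
all `q ∣ M` being `≡ 2 (mod 3)` and simple), while the ten further Eisenstein curves at square-free sign-admissible levels
(`2295a,c,e,f,h,i`, `3915b,d`, `7155k,l`) have MIXED signs and are not degenerate — Tamagawa numbers do not see this
(`2295a1`, `7155k1`: `μ₃ ⊂ E`, `3 ∤ c_q`) — and the eleven sign-coherent `μ₃`-curves with a `q ≡ 1 (mod 3)` (`189b1`,
`1971f1`, `5859e1` with `3 ∤ c_q` everywhere; `189c1, 1755c1, 2457b1, 2457j1, 3213u1, 5805j1, 5859f1, 8235j1`) are not
degenerate either: uniformly, `t₃ = 1 ⟺ a_q(E) = −ψ_C(Frob_q)` at every `q ∣ M` for a rational order-3 subgroup `C`.  (5) THE KIND LAW (E-desc-126): kind nsq iff `Δ/3^{v₃(Δ)} ≡ 1 (mod 3)` (260/260),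
kind sq iff `≡ 2 (mod 3)` (308/308).  (6) TWINS: 273 optimal `χ₋₃`-pairs at one level: same kind, same height, `t₃` equal,
`deg` ratio 3 (II ↔ IV*, IV ↔ II*: 260) or 1 (13 pairs II ↔ II up to a rational 3-isogeny; 22 CM `j = 0` curves are twin-less).
KERNEL ANCHORS (§6 end): `F189a1`, `F189d1` (`p = 7`, nsq), `F297d1` (`p = 11`, sq), `F459c1` (`p = 17`, nsq, `t₃ = 1`) with
`decide +kernel` certificates of unit invariance, two Hecke eigen-equations, the height and the row arithmetic.

What is NOT in print (presearch, corpus fts+vec AND galaxy, 2026-08-29): a Brandt-module-with-character / Gross-height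
formula for the modular degree at a depth-ONE supercuspidal prime, its `3^{1+b−t₃}` correction, the sign-coherent `μ₃`
Eisenstein clause, or the kind law — no hits for "Brandt module with character" ∧ "modular degree" ∧ ("conductor 27" ∨
"supercuspidal") in corpus (`lit search --hybrid`, `lit vsearch`: nearest generic [corpus:bump1997-automorphic-forms-representations
p.575] types of supercuspidals, [corpus:hida2000-modular-forms-galois-cohomology p.399]) and galaxy (`lit galaxy search
"Brandt module with character|Brandt matrices with character" --star all`: [galaxy:pdf:-8439920342258766180] Dembélé,
quaternionic Manin symbols / Brandt matrices for Hilbert modular forms — algorithmic dictionary only; `"3-Eisenstein|Eisenstein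
prime 3|rational 3-isogeny" --star pdf`: no relevant hit).  In print and used only as DICTIONARY: Jacquet–Langlands with types,
[cite: Gross1987Heights] (Eichler orders), [cite: PollackWeston2011, Thm. 6.8] (square-free levels), [cite: CremonaEcdata].
PARTITION: 0 new PROVED by-name theorems toward C2/C3 (two typed `@[conjecture]` rows + one proved bookkeeping iff + kernel
certificates); beyond-print theorem: no; BSD is not proved by this, the Manin conjecture is not proved by this, C2/C3 OPEN.
-/

namespace Summit.BirchSwinnertonDyer.Rank1Residual.ManinAdditive.ThetaFourBrandt

open scoped MatrixGroups ModularForm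
open CongruenceSubgroup WeierstrassCurve Literature.NumberTheory.EllipticCurves.ModularForms
open Summit.BirchSwinnertonDyer.Rank1Residual.ManinAdditive.HurwitzBrandt (DQuat toPoint)

/-! ### §6. `27 ∥ N`: the depth-one (conductor-27 supercuspidal) module of `B_{3,∞}` and row E-desc-125

At `v₃(N) = 3` every local type is a RAMIFIED supercuspidal of conductor `27`; under Jacquet–Langlands these are the
`O_3^×`-types of DEPTH ONE: characters of `O^× → (O/3O)^×` non-trivial on `1 + 𝔓` (`𝔓 = jO`, `𝔓² = 3O`).  Write
`O/3O = 𝔽₉ ⊕ j𝔽₉` (`𝔽₉ = 𝔽₃[i]`, `j a = ā j`, `j² = 0`); a unit is `a(1 + j y)` and `1 + 𝔓 ∋ 1 + jy ↦ y ∈ (𝔽₉, +)`.  Fix the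
additive character `ψ_α(y) = ω^{Tr(α y)}` (`ω = e^{2πi/3}`, `Tr = Tr_{𝔽₉/𝔽₃}`); up to the action of `𝔽₉^×` by squares there are
TWO classes of `α`: squares (`α = 1`, "kind sq") and non-squares (`α = 1 + i`, "kind nsq") — the two `4`-dimensional
irreducibles `Ind ψ_α` of `(O/3O)^×/𝔽₃^×` (order `36 = 4·1² + 2·4²`), i.e. the two Galois-orbits of conductor-27 types.
THE MODULE `M_α(p)`: functions `F : (𝔽₉^×/±1) × ℙ¹(𝔽_p) → ℤ[ω]` (`4(p+1)` values; `𝔽₉^×/±1` represented by `aRep =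
(1, i, 1+i, 1−i)`), with the twisted left action of `γ ∈ O` prime to `3`, `γ ≡ c + j d (mod 3O)`:
`(L_γ F)(a, x) = ω^{Tr(α · d a / (c̄ ā))} · F([c a], γ·x)` (`pull27`); `M_α(p) = {F : L_u F = F ∀ u ∈ O^×}`
(`IsUnitInvariant27`); `T_ℓ = (1/12) Σ_{Nrd γ = ℓ} L_γ` (`depthOneHecke12 = 12·T_ℓ`); point weights `w = |Stab_{O^×}|/2 ∈
{1, 3}` (`stabWeight27`; `3` only at `p ≡ 1 (mod 3)`); `⟨F, F⟩₆ = Σ w² Nm F = 6·Σ_orbits w·Nm` (`depthOneHeightSix`).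
JACQUET–LANGLANDS CHECK (BC5 for the dictionary, HOME/desc/g18/b27/JL27-CHECK-499.txt): `dim M_sq(M) + dim M_nsq(M) =
Σ_{d ∣ M} σ₀(M/d) · dim S₂^{new}(27d)` at ALL 166 odd levels `M < 500` prime to 3 (no Eisenstein and no depth-zero
content: the types are genuinely depth one).
CENSUS (HOME/desc/g18/b27/CENSUS-27.md, 568 curves, 87 levels): every `X₀(N)`-optimal `E` with `27 ∥ N = 27M ≤ 9747`, `M` odd, has a Hecke
eigenline in EXACTLY ONE of `M_sq(M) ⊗ ℚ(ω)`, `M_nsq(M) ⊗ ℚ(ω)` (none in the other), of rank one over `ℤ[ω]`; with `F_E` its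
primitive generator, `deg φ_E = 3^{1 + b(E) − t₃(E)} · ⟨F_E, F_E⟩`, `b(E) = [Kodaira IV* or II* at 3] = [v₃(Δ) ≥ 9]`
(`IsDeepAtTwentySeven`), `t₃(E) = [sign-coherent 3-Eisenstein degenerate]` (`IsThreeEisensteinDegenerateAtTwentySeven`:
`M` square-free with all prime factors `≡ 2 (mod 3)` and a rational order-3 subgroup — `ℤ/3` with `E` NON-SPLIT at every
`q ∣ M`, or `μ₃` with `E` SPLIT at every `q ∣ M` — i.e. an Eisenstein subgroup that is TORIC at every `q ∣ M`; 6 of 568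
curves) — 568/568; in particular `ord_ℓ deg φ = ord_ℓ ⟨F_E,F_E⟩` for EVERY `ℓ ≠ 3` including `ℓ = 2` (568/568): at
`27 ∥ N` the `3`-part of the modular degree is read off the Kodaira symbol and one Eisenstein bit, and there is NO
`2`-correction.  The KIND is read off `Δ`: nsq iff `Δ/3^{v₃(Δ)} ≡ 1 (mod 3)` (row E-desc-126, 568/568).  Twins: the 273
optimal `χ₋₃`-twist pairs at one level have the same kind, the SAME generator height, `t₃` equal, and `deg φ` ratio `3`
(II ↔ IV*, IV ↔ II*; 260 pairs) or `1` (13 pairs II ↔ II up to isogeny: the twist is the non-optimal IV* member of a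
3-isogenous partner class whose optimal curve is II; the 22 twin-less curves are the CM curves `j = 0`).
[cite: CremonaEcdata] [cite: Gross1987Heights, §§1–3 (Brandt matrices and heights for Eichler orders; dictionary only)]
[cite: PollackWeston2011, Thm. 6.8 (square-free shape only)] — the depth-one module, its two kinds and the `3`-adic law are
the cell's (desc g18 EXTRA), NOT in print. -/

section DepthOne
open Summit.BirchSwinnertonDyer.Rank1Residual.ManinAdditive.ThetaBrandt (ZOmega)
open Summit.BirchSwinnertonDyer.Rank1Residual.ManinAdditive.RamanujanCut (HasRationalThreeTorsion)

/-- `𝔽₉ = 𝔽₃[i]` as pairs of naturals (junk-free use: components are always reduced `mod 3` by the operations). [folklore] -/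
abbrev F9 : Type := ℕ × ℕ

/-- product in `𝔽₉ = 𝔽₃[i]` (`i² = −1 ≡ 2`). [folklore] -/
def F9.mul (u v : F9) : F9 := ((u.1 * v.1 + 2 * u.2 * v.2) % 3, (u.1 * v.2 + u.2 * v.1) % 3)

/-- Frobenius / conjugation `x + yi ↦ x − yi`. [folklore] -/
def F9.frob (u : F9) : F9 := (u.1 % 3, (2 * u.2) % 3)

/-- inverse on `𝔽₉^×` as `u⁷` (junk `0 ↦ 0`). [folklore] -/
def F9.inv (u : F9) : F9 := F9.mul u (F9.mul (F9.mul u u) (F9.mul (F9.mul u u) (F9.mul u u)))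

/-- `Tr_{𝔽₉/𝔽₃}(x + yi) = 2x ∈ {0,1,2}`. [folklore] -/
def F9.tr (u : F9) : ℕ := (2 * u.1) % 3

/-- reduction `O → O/3O = 𝔽₉ ⊕ j𝔽₉`, `q ↦ (c, d)` with `q ≡ c + j d`: for the doubled coordinates `q = (A, B, C, D)` of
`HurwitzBrandt.DQuat` read in `O = ℤ⟨1, i, (1+j)/2, (i+k)/2⟩ ⊂ (−1,−3)_ℚ` one has `c = −(A + Bi)`, `d = −C + Di (mod 3)`. [folklore] -/
def red3 (q : DQuat) : F9 × F9 :=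
  ((((-q.1) % 3).toNat, ((-q.2.1) % 3).toNat), (((-q.2.2.1) % 3).toNat, (q.2.2.2 % 3).toNat))

/-- representatives `1, i, 1+i, 1−i` of `𝔽₉^×/±1`. [folklore] -/
def aRep : Fin 4 → F9 := ![(1, 0), (0, 1), (1, 1), (1, 2)]

/-- the class of `u ∈ 𝔽₉^×` in `𝔽₉^×/±1 ≅ Fin 4` (junk `0 ↦ 0`). [folklore] -/
def aClass (u : F9) : Fin 4 :=
  if u.2 % 3 = 0 then 0 else if u.1 % 3 = 0 then 1 else if (u.1 + 2 * u.2) % 3 = 0 then 2 else 3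

/-- the character parameter: `α = 1` (kind sq, `nsq = false`) or `α = 1 + i` (kind nsq, `nsq = true`). [folklore] -/
def psiAlpha (nsq : Bool) : F9 := if nsq then (1, 1) else (1, 0)

/-- the multiplier exponent `Tr(α · d a / (c̄ ā)) ∈ {0,1,2}` of `L_γ` at the class of `a`, `γ ≡ c + jd`. [folklore] -/
def multExp27 (nsq : Bool) (q : DQuat) (k : Fin 4) : ℕ :=
  F9.tr (F9.mul (psiAlpha nsq)
    (F9.mul (F9.mul (red3 q).2 (aRep k)) (F9.inv (F9.mul (F9.frob (red3 q).1) (F9.frob (aRep k))))))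

/-- the `𝔽₉^×/±1`-coordinate of `γ · (a, x)`: the class of `c a`. [folklore] -/
def actA (q : DQuat) (k : Fin 4) : Fin 4 := aClass (F9.mul (red3 q).1 (aRep k))

/-- the twisted pull-back `(L_γ F)(a, x) = ω^{Tr(α d a/(c̄ ā))} · F([ca], γ x)`. [folklore] -/
def pull27 (p : ℕ) (nsq : Bool) (q : DQuat) (F : Fin 4 → Fin (p + 1) → ZOmega) (k : Fin 4) (x : Fin (p + 1)) : ZOmega :=
  ZOmega.omegaPowMul (multExp27 nsq q k) (F (actA q k) (act3 p q x))

/-- membership in the depth-one module `M_α(p)`: invariance under the twelve units. [folklore] -/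
def IsUnitInvariant27 (p : ℕ) (nsq : Bool) (F : Fin 4 → Fin (p + 1) → ZOmega) : Prop :=
  ∀ u ∈ dicyclicUnits, ∀ (k : Fin 4) (x : Fin (p + 1)), pull27 p nsq u F k x = F k x

/-- point weight `w(a, x) = |Stab_{O^×}(a, x)|/2 ∈ {1, 3}`. [folklore] -/
def stabWeight27 (p : ℕ) (k : Fin 4) (x : Fin (p + 1)) : ℕ :=
  (dicyclicUnits.filter fun u => decide (actA u k = k ∧ act3 p u x = x)).length / 2

/-- `W F = w · F` pointwise. [folklore] -/
def weightMul27 (p : ℕ) (F : Fin 4 → Fin (p + 1) → ZOmega) (k : Fin 4) (x : Fin (p + 1)) : ZOmega :=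
  ((stabWeight27 p k x : ℤ) * (F k x).1, (stabWeight27 p k x : ℤ) * (F k x).2)

/-- `12 · T_ℓ = Σ_{Nrd γ = ℓ} L_γ` on point functions. [folklore] -/
def depthOneHecke12 (p : ℕ) (nsq : Bool) (ℓ : ℕ) (F : Fin 4 → Fin (p + 1) → ZOmega) (k : Fin 4) (x : Fin (p + 1)) :
    ZOmega :=
  ((dicyclicOfNorm ℓ).map fun q => pull27 p nsq q F k x).foldr ZOmega.add (0, 0)

/-- `W F` is a `T_ℓ`-eigenfunction with eigenvalue `a ℓ` for every prime `ℓ ∤ 3p`. [folklore] -/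
def IsDepthOneHeckeEigen (p : ℕ) (nsq : Bool) (F : Fin 4 → Fin (p + 1) → ZOmega) (a : ℕ → ℤ) : Prop :=
  ∀ ℓ : ℕ, ℓ.Prime → ℓ ≠ 3 → ℓ ≠ p → ∀ (k : Fin 4) (x : Fin (p + 1)),
    depthOneHecke12 p nsq ℓ (weightMul27 p F) k x =
      (12 * a ℓ * (weightMul27 p F k x).1, 12 * a ℓ * (weightMul27 p F k x).2)

/-- primitivity over `ℤ[ω]`: every common divisor of the values is a unit. [folklore] -/
def IsPrimitive27 (p : ℕ) (F : Fin 4 → Fin (p + 1) → ZOmega) : Prop :=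
  ∀ d : ZOmega, (∀ (k : Fin 4) (x : Fin (p + 1)), ∃ q : ZOmega, F k x = ZOmega.mul d q) → ZOmega.norm d = 1

/-- `⟨F, F⟩₆ = Σ_{(a,x)} w(a,x)² · Nm F(a,x) = 6 · Σ_orbits w · Nm` (six times the Gross height). [folklore] -/
def depthOneHeightSix (p : ℕ) (F : Fin 4 → Fin (p + 1) → ZOmega) : ℤ :=
  ∑ k : Fin 4, ∑ x : Fin (p + 1), (stabWeight27 p k x : ℤ) ^ 2 * ZOmega.norm (F k x)

/-- `b(E) = 1`: Kodaira IV* or II* at `3` given `27 ∥ N` (`v₃(Δ_min) ∈ {9, 11}` versus `{3, 5}` for II, IV). [folklore] -/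
def IsDeepAtTwentySeven (W : WeierstrassCurve ℚ) : Prop :=
  padicValNat 3 (W.conductorNorm ℤ) = 3 ∧ 9 ≤ padicValRat 3 W.Δ

/-- `μ₃ ⊂ E`: a rational root `x` of the 3-division polynomial whose points `(x, y₀)` are defined over `ℚ(√−3)` and
swapped by its Galois group — `(2y₀ + a₁x + a₃)² = 4x³ + b₂x² + 2b₄x + b₆ = −3·y²` with `y ∈ ℚ` (automatically `y ≠ 0`);
the subgroup `{0, ±(x, y₀)}` is then Galois-stable with character `χ₋₃`, i.e. isomorphic to `μ₃`.  (The twin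
`HasRationalThreeTorsion` of `RamanujanCut` is the case "`+` a rational square", i.e. `ℤ/3 ⊂ E`.) [folklore] -/
def HasRationalMuThree (W : WeierstrassCurve ℚ) : Prop :=
  ∃ x y : ℚ, W.Ψ₃.eval x = 0 ∧ 4 * x ^ 3 + W.b₂ * x ^ 2 + 2 * W.b₄ * x + W.b₆ = -3 * y ^ 2

/-- **3-Eisenstein degeneracy at `27 ∥ N`** (`t₃(E) = 1`; desc g18 EXTRA, CENSUS-27 §2).  The census-exact criterion is
SIGN-COHERENT: `N/27` is square-free with every prime factor `q ≡ 2 (mod 3)`, and `E` carries a rational subgroup `C` of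
order 3 with character `ψ ∈ {1, χ₋₃}` (`ℤ/3 ⊂ E` or `μ₃ ⊂ E`) such that `a_q(E) = −ψ(q)` at EVERY prime `q ∣ N/27` —
non-split multiplicative everywhere for `ℤ/3`, split multiplicative everywhere for `μ₃`; equivalently `C` reduces into the
TORUS of the Néron model at every `q ∣ N/27` (`C|_{G_q} ≅ μ₃ ⊗ δ_q`, `δ_q` the unramified character `Frob_q ↦ a_q`).  The
verbatim twin of `ThetaBrandt.IsThreeEisensteinDegenerateAtFour` ("`E(ℚ)[3] ≠ 0`, `3 ∤ c_q`, `q ≡ 2 (3)`") is the `ℤ/3`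
half (there non-split is forced: a rational 3-torsion point in the identity component of a split torus needs `q ≡ 1 (3)`);
the `μ₃` half is NEW at `27 ∥ N` (both members of a `χ₋₃`-twist pair II ↔ IV* degenerate together) and is NOT detected
by Tamagawa numbers (2295a1, 7155k1: `μ₃ ⊂ E`, `3 ∤ c_q`, mixed signs, not degenerate); the clause `q ≡ 2 (mod 3)` is
load-bearing on the `μ₃` half (189b1, 1971f1, 5859e1: `μ₃ ⊂ E`, split with `3 ∤ c_q` at every `q ∣ M`, some `q ≡ 1 (mod 3)`,
not degenerate).  UNIFORM READING: `t₃(E) = 1` iff `E` has a rational subgroup `C` of order 3 with `a_q(E) = −ψ_C(Frob_q)`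
for EVERY prime `q ∣ N/27` (`ψ_C ∈ {1, χ₋₃}` its character) — square-freeness and `q ≡ 2 (mod 3)` are then forced by the
Tate curve (a curve with `E(ℚ_q)[3] ≠ 0` cannot be non-split multiplicative at `q ≡ 1 (mod 3)`), so the definition below
is the same condition with the forced clauses spelled out; `−ψ_C(Frob_q)` is the quantity of the cell's sign row
E-desc-122 (`s = −ψ_{C₀}(2)` at `4 ∥ N`). [folklore] -/
def IsThreeEisensteinDegenerateAtTwentySeven (W : WeierstrassCurve ℚ) : Prop :=
  (∀ q : ℕ, q.Prime → q ≠ 3 → q ∣ W.conductorNorm ℤ → ¬ q ^ 2 ∣ W.conductorNorm ℤ ∧ q % 3 = 2) ∧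
    ((HasRationalThreeTorsion W ∧ ∀ q : ℕ, q.Prime → q ≠ 3 → q ∣ W.conductorNorm ℤ → W.LFunction q = -1) ∨
      (HasRationalMuThree W ∧ ∀ q : ℕ, q.Prime → q ≠ 3 → q ∣ W.conductorNorm ℤ → W.LFunction q = 1))

/-- the KIND of `E` (which of the two conductor-27 Galois orbits of types): `Δ_min / 3^{v₃(Δ_min)} ≡ 1 (mod 3)` — kind nsq —
versus `≡ 2 (mod 3)` — kind sq (CENSUS-27 §3: 0 exceptions; dictionary: nsq ⟺ `ℚ₃(√Δ) = ℚ₃(√3)`, sq ⟺ `ℚ₃(√Δ) = ℚ₃(√−3)`,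
`v₃(Δ)` being odd at `27 ∥ N`). [folklore] -/
def IsNonSquareKindAtTwentySeven (W : WeierstrassCurve ℚ) : Prop :=
  padicValNat 3 (W.conductorNorm ℤ) = 3 ∧ ∃ u : ℤ, W.Δ = (3 : ℚ) ^ (padicValRat 3 W.Δ).toNat * (u : ℚ) ∧ u % 3 = 1

open scoped Classical in
/-- **Row E-desc-125 `DepthOneBrandtDegreeLawAtTwentySevenPrime` (LAW, identity; cell bsd-f2-manin, desc g18 EXTRA,
MEMO-desc §40; nothing asserted).**  For an `X₀(N)`-optimal curve of conductor `N = 27p`, `p ≥ 5` prime, a kind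
`α ∈ {sq, nsq}` and a primitive `F ∈ M_α(p)` whose weighted function `W F` is a Hecke eigenfunction for `(a_ℓ(E))_{ℓ ∤ 3p}`
(such `F` exist for exactly one kind, uniquely up to `ℤ[ω]^×`):
`3^{t₃(E)} · 6 deg φ = 3^{1 + b(E)} · ⟨F, F⟩₆`, i.e. `deg φ = 3^{1 + b − t₃} · ⟨F, F⟩` — see the section docstring for `b`, `t₃`
and the census (568/568 optimal curves with `27 ∥ N ≤ 9747`; the row is the prime-level case `N = 27p`, `5 ≤ p ≤ 359`).  Why it might fail: a
`μ₃ ⊂ E` curve, split at every `q ∣ N/27 ≡ 2 (3)` but with `3 ∣ v_q(Δ)` (no such optimal curve `≤ 9990`: whether the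
`μ₃` half needs a Tamagawa clause is untested), or an accidental second congruence modulo `(1 − ω)²` (`t₃ = 2`).
[cite: CremonaEcdata] [cite: Gross1987Heights, §3 (dictionary only)] [cite: PollackWeston2011, Thm. 6.8 (shape only)] -/
@[conjecture]
def DepthOneBrandtDegreeLawAtTwentySevenPrime : Prop :=
  ∀ (p : ℕ), p.Prime → 5 ≤ p →
  ∀ (W : WeierstrassCurve ℚ) [W.IsElliptic] [W.IsGloballyMinimal] [NeZero (W.conductorNorm ℤ)]
    (D : ModularParametrizationData W (W.conductorNorm ℤ)),
    W.conductorNorm ℤ = 27 * p →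
    (∀ z ∈ D.L.lattice, ∃ w ∈ periodLattice D.f, z = D.c * w) →
    (∀ (W' : WeierstrassCurve ℚ) [W'.IsElliptic]
        (D' : ModularParametrizationData W' (W.conductorNorm ℤ)),
        D'.f = D.f → D.modularDegree ≤ D'.modularDegree) →
  ∀ (nsq : Bool) (F : Fin 4 → Fin (p + 1) → ZOmega),
    IsUnitInvariant27 p nsq F → IsPrimitive27 p F → IsDepthOneHeckeEigen p nsq F (fun n => W.LFunction n) →
    (3 : ℤ) ^ (if IsThreeEisensteinDegenerateAtTwentySeven W then 1 else 0) * 6 * (D.modularDegree : ℤ) =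
      3 ^ (1 + if IsDeepAtTwentySeven W then 1 else 0) * depthOneHeightSix p F

/-- at prime level `N = 27p` the degeneracy criterion reads: `p ≡ 2 (mod 3)` and (`ℤ/3 ⊂ E ∧ a_p = −1`) or
(`μ₃ ⊂ E ∧ a_p = +1`) (pure logic from the definition). -/
theorem isThreeEisensteinDegenerateAtTwentySeven_iff_of_conductor_eq {p : ℕ} (hp : p.Prime) (h5 : 5 ≤ p)
    {W : WeierstrassCurve ℚ} (hN : W.conductorNorm ℤ = 27 * p) :
    IsThreeEisensteinDegenerateAtTwentySeven W ↔
      p % 3 = 2 ∧ ((HasRationalThreeTorsion W ∧ W.LFunction p = -1) ∨ (HasRationalMuThree W ∧ W.LFunction p = 1)) := by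
  have hp3 : p ≠ 3 := by omega
  have h27 : (27 : ℕ) = 3 ^ 3 := by norm_num
  have hpN : (p : ℕ) ∣ W.conductorNorm ℤ := hN ▸ dvd_mul_left p 27
  -- the only prime `q ≠ 3` dividing `27p` is `p`
  have honly : ∀ q : ℕ, q.Prime → q ≠ 3 → q ∣ W.conductorNorm ℤ → q = p := by
    intro q hq hq3 hqN
    rw [hN] at hqN
    have hq27 : ¬ q ∣ 27 := by
      rw [h27]; intro h; exact hq3 ((Nat.prime_dvd_prime_iff_eq hq Nat.prime_three).1 (hq.dvd_of_dvd_pow h))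
    rcases (Nat.Prime.dvd_mul hq).1 hqN with h | h
    · exact absurd h hq27
    · exact (Nat.prime_dvd_prime_iff_eq hq hp).1 h
  have hsq : ¬ p ^ 2 ∣ W.conductorNorm ℤ := by
    rw [hN]
    intro hdvd
    have h2 : p ∣ 27 := by
      have : p * p ∣ 27 * p := by simpa [pow_two] using hdvd
      exact Nat.dvd_of_mul_dvd_mul_right hp.pos (by simpa [mul_comm] using this)
    have : p ∣ 3 := by rw [h27] at h2; exact hp.dvd_of_dvd_pow h2
    have := Nat.le_of_dvd (by norm_num) this
    omega
  constructor
  · rintro ⟨hloc, hglob⟩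
    refine ⟨(hloc p hp hp3 hpN).2, ?_⟩
    rcases hglob with ⟨hT, hs⟩ | ⟨hM, hs⟩
    · exact Or.inl ⟨hT, hs p hp hp3 hpN⟩
    · exact Or.inr ⟨hM, hs p hp hp3 hpN⟩
  · rintro ⟨hmod, hglob⟩
    refine ⟨fun q hq hq3 hqN => ?_, ?_⟩
    · obtain rfl := honly q hq hq3 hqN
      exact ⟨hsq, hmod⟩
    · rcases hglob with ⟨hT, hs⟩ | ⟨hM, hs⟩
      · exact Or.inl ⟨hT, fun q hq hq3 hqN => by obtain rfl := honly q hq hq3 hqN; exact hs⟩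
      · exact Or.inr ⟨hM, fun q hq hq3 hqN => by obtain rfl := honly q hq hq3 hqN; exact hs⟩

open scoped Classical in
/-- **Row E-desc-126 `DepthOneKindLawAtTwentySevenPrime` (LAW; desc g18 EXTRA; nothing asserted).**  The kind carrying the
eigenline of an optimal `E` of conductor `27p` is nsq iff `Δ_min/3^{v₃(Δ_min)} ≡ 1 (mod 3)` (CENSUS-27 §3: all 308 kind-sq
curves have `Δ' ≡ 2`, all 260 kind-nsq curves have `Δ' ≡ 1 (mod 3)` — no exception among the 568 optimal curves with
`27 ∥ N ≤ 9747`).  Why it might fail: only if the dictionary "kind ↔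
`ℚ₃(√Δ)`" is an artefact of the embedding conventions at some prime `p > 367` (it is convention-free: both engines agree). -/
@[conjecture]
def DepthOneKindLawAtTwentySevenPrime : Prop :=
  ∀ (p : ℕ), p.Prime → 5 ≤ p →
  ∀ (W : WeierstrassCurve ℚ) [W.IsElliptic] [W.IsGloballyMinimal] [NeZero (W.conductorNorm ℤ)]
    (D : ModularParametrizationData W (W.conductorNorm ℤ)),
    W.conductorNorm ℤ = 27 * p →
    (∀ z ∈ D.L.lattice, ∃ w ∈ periodLattice D.f, z = D.c * w) →
  ∀ (nsq : Bool) (F : Fin 4 → Fin (p + 1) → ZOmega),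
    IsUnitInvariant27 p nsq F → IsPrimitive27 p F → IsDepthOneHeckeEigen p nsq F (fun n => W.LFunction n) →
    (nsq = true ↔ IsNonSquareKindAtTwentySeven W)

/-! #### kernel anchors for §6 (Cremona 189a1, 189d1 at `p = 7`, kind nsq; 297d1 at `p = 11`, kind sq; 459c1 at `p = 17`,
kind nsq, the 3-Eisenstein degenerate case) — ported by HOME/desc/g18/b27/leanport27.py; each block certifies unit
invariance, `W F = F`, the Hecke relations at two primes, the height and the row's arithmetic. -/

/-- `u · u⁻¹ = 1` for the eight units of `𝔽₉` in the file's coordinates (`F9.inv u = u⁷`). -/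
theorem F9.mul_inv_self : ∀ u ∈ [((1 : ℕ), (0 : ℕ)), (2, 0), (0, 1), (0, 2), (1, 1), (1, 2), (2, 1), (2, 2)],
    F9.mul u (F9.inv u) = (1, 0) := by decide +kernel

/-- every one of the 12 units of `O` reduces to a non-zero first `𝔽₉`-coordinate under `red3`. -/
theorem red3_units_c_ne_zero : ∀ u ∈ dicyclicUnits, (red3 u).1 ≠ (0, 0) := by decide +kernel

/-- the primitive depth-one eigenfunction of Cremona 189a1 (`p = 7`, kind nsq), ported by leanport27.py. [cite: CremonaEcdata] -/
def F189a1 : Fin 4 → Fin 8 → ZOmega :=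
  ![![(0, -1), (0, 0), (1, 1), (0, -1), (-1, 0), (-1, 0), (0, 0), (1, 1)],
    ![(1, 1), (0, 0), (0, -1), (1, 1), (-1, 0), (-1, 0), (0, 0), (0, -1)],
    ![(0, 1), (0, 0), (1, 0), (1, 0), (0, 1), (-1, -1), (0, 0), (-1, -1)],
    ![(-1, -1), (0, 0), (1, 0), (1, 0), (-1, -1), (0, 1), (0, 0), (0, 1)]]

/-- 189a1: unit invariance, `W F = F`, `12·T_2` and `12·T_5` with `a_2 = -2`, `a_5 = -1`, `⟨F,F⟩₆ = 24`, and row E-desc-125's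
identity `3^0 · 6 · 12 = 3^1 · 24` (`deg φ = 12`, `t₃ = 0`, `b = 0`). -/
theorem F189a1_certificates : IsUnitInvariant27 7 true F189a1 ∧ (∀ (k : Fin 4) (x : Fin 8), weightMul27 7 F189a1 k x = F189a1 k x) ∧
    (∀ (k : Fin 4) (x : Fin 8), depthOneHecke12 7 true 2 F189a1 k x = (12 * (-2) * (F189a1 k x).1, 12 * (-2) * (F189a1 k x).2)) ∧
    (∀ (k : Fin 4) (x : Fin 8), depthOneHecke12 7 true 5 F189a1 k x = (12 * (-1) * (F189a1 k x).1, 12 * (-1) * (F189a1 k x).2)) ∧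
    depthOneHeightSix 7 F189a1 = 24 ∧ ((3 : ℤ) ^ 0 * 6 * 12 = 3 ^ (1 + 0) * 24) := by
  unfold IsUnitInvariant27
  refine ⟨?_, ?_, ?_, ?_, ?_, ?_⟩ <;> decide +kernel
/-- the primitive depth-one eigenfunction of Cremona 189d1 (`p = 7`, kind nsq), ported by leanport27.py. [cite: CremonaEcdata] -/
def F189d1 : Fin 4 → Fin 8 → ZOmega :=
  ![![(0, 1), (0, 0), (-1, -1), (0, 1), (1, 0), (1, 0), (0, 0), (-1, -1)],
    ![(-1, -1), (0, 0), (0, 1), (-1, -1), (1, 0), (1, 0), (0, 0), (0, 1)],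
    ![(0, 1), (0, 0), (1, 0), (1, 0), (0, 1), (-1, -1), (0, 0), (-1, -1)],
    ![(-1, -1), (0, 0), (1, 0), (1, 0), (-1, -1), (0, 1), (0, 0), (0, 1)]]

/-- 189d1: unit invariance, `W F = F`, `12·T_2` and `12·T_5` with `a_2 = 2`, `a_5 = 1`, `⟨F,F⟩₆ = 24`, and row E-desc-125's
identity `3^0 · 6 · 36 = 3^2 · 24` (`deg φ = 36`, `t₃ = 0`, `b = 1`). -/
theorem F189d1_certificates : IsUnitInvariant27 7 true F189d1 ∧ (∀ (k : Fin 4) (x : Fin 8), weightMul27 7 F189d1 k x = F189d1 k x) ∧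
    (∀ (k : Fin 4) (x : Fin 8), depthOneHecke12 7 true 2 F189d1 k x = (12 * (2) * (F189d1 k x).1, 12 * (2) * (F189d1 k x).2)) ∧
    (∀ (k : Fin 4) (x : Fin 8), depthOneHecke12 7 true 5 F189d1 k x = (12 * (1) * (F189d1 k x).1, 12 * (1) * (F189d1 k x).2)) ∧
    depthOneHeightSix 7 F189d1 = 24 ∧ ((3 : ℤ) ^ 0 * 6 * 36 = 3 ^ (1 + 1) * 24) := by
  unfold IsUnitInvariant27
  refine ⟨?_, ?_, ?_, ?_, ?_, ?_⟩ <;> decide +kernel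
/-- the primitive depth-one eigenfunction of Cremona 297d1 (`p = 11`, kind sq), ported by leanport27.py. [cite: CremonaEcdata] -/
def F297d1 : Fin 4 → Fin 12 → ZOmega :=
  ![![(1, 1), (0, 1), (0, -1), (0, -1), (-1, 0), (-1, -1), (1, 0), (-1, -1), (1, 0), (-1, 0), (1, 1), (0, 1)],
    ![(0, 1), (1, 1), (-1, -1), (-1, -1), (1, 0), (0, -1), (-1, 0), (0, -1), (-1, 0), (1, 0), (0, 1), (1, 1)],
    ![(-1, 0), (-1, 0), (1, 0), (-1, 0), (1, 0), (-1, 0), (1, 0), (1, 0), (-1, 0), (-1, 0), (1, 0), (1, 0)],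
    ![(1, 0), (1, 0), (-1, 0), (1, 0), (-1, 0), (1, 0), (-1, 0), (-1, 0), (1, 0), (1, 0), (-1, 0), (-1, 0)]]

/-- 297d1: unit invariance, `W F = F`, `12·T_2` and `12·T_5` with `a_2 = 2`, `a_5 = 2`, `⟨F,F⟩₆ = 48`, and row E-desc-125's
identity `3^0 · 6 · 24 = 3^1 · 48` (`deg φ = 24`, `t₃ = 0`, `b = 0`). -/
theorem F297d1_certificates : IsUnitInvariant27 11 false F297d1 ∧ (∀ (k : Fin 4) (x : Fin 12), weightMul27 11 F297d1 k x = F297d1 k x) ∧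
    (∀ (k : Fin 4) (x : Fin 12), depthOneHecke12 11 false 2 F297d1 k x = (12 * (2) * (F297d1 k x).1, 12 * (2) * (F297d1 k x).2)) ∧
    (∀ (k : Fin 4) (x : Fin 12), depthOneHecke12 11 false 5 F297d1 k x = (12 * (2) * (F297d1 k x).1, 12 * (2) * (F297d1 k x).2)) ∧
    depthOneHeightSix 11 F297d1 = 48 ∧ ((3 : ℤ) ^ 0 * 6 * 24 = 3 ^ (1 + 0) * 48) := by
  unfold IsUnitInvariant27
  refine ⟨?_, ?_, ?_, ?_, ?_, ?_⟩ <;> decide +kernel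
/-- the primitive depth-one eigenfunction of Cremona 459c1 (`p = 17`, kind nsq), ported by leanport27.py. [cite: CremonaEcdata] -/
def F459c1 : Fin 4 → Fin 18 → ZOmega :=
  ![![(-2, -2), (-1, 0), (-1, 0), (1, 1), (0, -1), (0, -1), (0, -1), (1, 1), (1, 1), (1, 1), (0, -1), (-1, 0), (-1, 0), (0, 2), (0, -1), (-1, 0), (1, 1), (2, 0)],
    ![(2, 0), (1, 1), (1, 1), (-1, 0), (0, -1), (0, -1), (0, -1), (-1, 0), (-1, 0), (-1, 0), (0, -1), (1, 1), (1, 1), (0, 2), (0, -1), (1, 1), (-1, 0), (-2, -2)],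
    ![(1, 0), (-1, -1), (-1, -1), (1, 0), (0, -2), (0, 1), (0, 1), (1, 0), (1, 0), (-2, 0), (0, 1), (-1, -1), (-1, -1), (0, 1), (0, 1), (2, 2), (1, 0), (-1, -1)],
    ![(-1, -1), (1, 0), (1, 0), (-1, -1), (0, -2), (0, 1), (0, 1), (-1, -1), (-1, -1), (2, 2), (0, 1), (1, 0), (1, 0), (0, 1), (0, 1), (-2, 0), (-1, -1), (1, 0)]]

/-- 459c1: unit invariance, `W F = F`, `12·T_2` and `12·T_5` with `a_2 = 0`, `a_5 = 3`, `⟨F,F⟩₆ = 108`, and row E-desc-125's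
identity `3^1 · 6 · 18 = 3^1 · 108` (`deg φ = 18`, `t₃ = 1`, `b = 0`). -/
theorem F459c1_certificates : IsUnitInvariant27 17 true F459c1 ∧ (∀ (k : Fin 4) (x : Fin 18), weightMul27 17 F459c1 k x = F459c1 k x) ∧
    (∀ (k : Fin 4) (x : Fin 18), depthOneHecke12 17 true 2 F459c1 k x = (12 * (0) * (F459c1 k x).1, 12 * (0) * (F459c1 k x).2)) ∧
    (∀ (k : Fin 4) (x : Fin 18), depthOneHecke12 17 true 5 F459c1 k x = (12 * (3) * (F459c1 k x).1, 12 * (3) * (F459c1 k x).2)) ∧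
    depthOneHeightSix 17 F459c1 = 108 ∧ ((3 : ℤ) ^ 1 * 6 * 18 = 3 ^ (1 + 0) * 108) := by
  unfold IsUnitInvariant27
  refine ⟨?_, ?_, ?_, ?_, ?_, ?_⟩ <;> decide +kernel

end DepthOne

end Summit.BirchSwinnertonDyer.Rank1Residual.ManinAdditive.ThetaFourBrandt
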